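import Mathlib
import Literature.AlgebraicGeometry.Resolution.AugmentationIdeal
import Literature.AlgebraicGeometry.Resolution.AffineBlowup
import Literature.AlgebraicGeometry.Resolution.AffineBlowupAlgebra
import Literature.AlgebraicGeometry.Resolution.BlowupChartTransition
import Summits.ResolutionOfSingularities.ResolutionOfSingularities.Theorems.WildQuotientsWildQuotientResolutionFixedPointsGraded
import Summits.ResolutionOfSingularities.ResolutionOfSingularities.Theorems.WildQuotientsWildQuotientResolutionInvolutionKLTwice
import Summits.ResolutionOfSingularities.ResolutionOfSingularities.Theorems.WildQuotientsWildQuotientResolutionInvolutionChartRegular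
import Summits.ResolutionOfSingularities.ResolutionOfSingularities.Theorems.WildQuotientsWildQuotientResolutionInvolutionChartDictionary
import Summits.ResolutionOfSingularities.ResolutionOfSingularities.Theorems.WildQuotientsWildQuotientResolutionInvolutionChartCover

/-!
# K–L twice, step 2: `Bl_{I_τ ∩ R₊}(Spec R₊)` is regular (card `mu2-strata-kl-twice`, (ii))

(crux stmt-ResolutionOfSingularities-15640 `WildQuotients.WildQuotientResolution`, line `Sketch`,
sector `|G| = p`; RUNG V5 of `L/w45c/CHAIN.md` v8.5, brick B7/`HP₂`; res-L1-w45c-plan-1 RULING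
HP₂ DIVISION 2026-08-27T13:49:46Z (ii) and ORDER 14:00:34Z «the general theorem
`InvolutionExit.isRegular_affineBlowup_comap_augIdeal` is now PURE ASSEMBLY of landed pieces».
[OURS · L1 W4.5c] — NOT a statement of any manuscript; replaces the role of no printed item.
Prover res-L1-w45c-stub-3.)

Setting: `R` a regular domain of finite type over a field `k`, `ι` a `k`-algebra involution of `R`
with `2 ∈ Rˣ`, `j : S ↪ R` the subring of `ι`-invariants, `K := I_ι.comap j` (`I_ι = augIdeal ι`).

* `isRegularRing_blowupAlgebra_comap_of_chart` — ONE CHART: for `y` anti-invariant, `y ≠ 0`,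
  `j t = y²`, and any spelling `C` of the Rees chart `R[I_ι/y]` with a ring involution `ιC` over `ι`
  whose augmentation ideal is `(y)` (H4), the chart ring `S[K/t]` is regular: `S[K/t] ≅ C^{ιC}`
  ((o1) `exists_chartRingHom`), `C` is a regular domain of finite type over `k`
  (`isRegularRing_involutionChart`), and K–L at the prime `2` (H5
  `isRegularRing_fixedPoints_of_involution`) applies to the `k`-involution `ιC ≠ 1`, `ιC² = 1`.
* `isRegularRing_blowupAlgebra_comap_sq` — the same with H4 (`involutionChartTerminal`) plugged in.
* **`isRegular_affineBlowup_comap_augIdeal_of_ringEquiv`**, **`isRegular_affineBlowup_comap_augIdeal`**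
  (`ι : R ≃ₐ[k] R`) — (ii): `Scheme.IsRegular (affineBlowup (I_ι.comap j))`, by the `y²`-chart
  cover (ε) `affineBlowup_isRegular_of_sq_charts` over the NONZERO anti-invariants (H1).
* `isRegular_affineBlowup_comap_augIdeal_fixedPoints` — the same with `j :=` the inclusion of
  `FixedPoints.subalgebra k R ⟨ι⟩` (the shape `R₀ := V^{τ̄} ↪ V` of res-type-036's ring side).
-/

-- single-problem summit: the doubled namespace component `ResolutionOfSingularities` is forced
set_option linter.dupNamespace false

noncomputable section

open AlgebraicGeometry IsLocalization Literature.AlgebraicGeometry.Resolution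
open Summit.ResolutionOfSingularities.ResolutionOfSingularities.Theorems.WildQuotientResolution.TameTransfer
  (mem_fixedPoints_zpowers_iff_apply_eq)

namespace Summit.ResolutionOfSingularities.ResolutionOfSingularities.Theorems.WildQuotientResolution.InvolutionExit

variable {k R S : Type} [Field k] [CommRing R] [IsDomain R] [IsRegularRing R] [Algebra k R]
  [Algebra.FiniteType k R] (ι : R ≃+* R) (hιk : ∀ a : k, ι (algebraMap k R a) = algebraMap k R a)
  (hι : ∀ x, ι (ι x) = x) (h2 : IsUnit (2 : R)) [CommRing S] (j : S →+* R)
  (hj : Function.Injective j) (hfix : ∀ x : R, x ∈ j.range ↔ ι x = x)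

include hιk hι h2 hj hfix in
/-- **One chart of `Bl_K(Spec R₊)` is regular** (abstract chart ring). For `y` anti-invariant and
nonzero, `j t = y²`, any spelling `C` of the Rees chart `R[I_ι/y]` which is a regular ring, and a ring
involution `ιC` of `C` over `ι` with augmentation ideal `(y)·C`, the affine blowup algebra `S[K/t]`
(`K = I_ι.comap j`) is a regular ring: it is `≅ C^{ιC}` ((o1)), and K–L at `2` (H5) applies to the
`k`-involution `ιC`. [OURS · L1 W4.5c, card `mu2-strata-kl-twice` (ii)] -/
theorem isRegularRing_blowupAlgebra_comap_of_chart {y : R} (hy : ι y = -y) (hy0 : y ≠ 0) (t : S)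
    (ht : j t = y ^ 2) (C : Subalgebra R (Localization.Away y))
    (hC : C = blowupAlgebra (augIdeal ι) y) [IsRegularRing C] (ιC : C ≃+* C)
    (hιCι : ∀ c, ιC (ιC c) = c)
    (hιC : ∀ r : R, ((ιC (algebraMap R C r) : C) : Localization.Away y) =
      algebraMap R (Localization.Away y) (ι r))
    (hprinc : Ideal.span (Set.range fun c => ιC c - c) = Ideal.span {algebraMap R C y}) :
    IsRegularRing (blowupAlgebra ((augIdeal ι).comap j) t) := by
  classical
  -- `C` is a domain of finite type over `k`
  haveI : IsDomain (Localization.Away y) :=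
    IsLocalization.isDomain_localization (powers_le_nonZeroDivisors_of_noZeroDivisors hy0)
  have hinjL : Function.Injective (algebraMap R (Localization.Away y)) :=
    IsLocalization.injective (Localization.Away y) (powers_le_nonZeroDivisors_of_noZeroDivisors hy0)
  haveI : IsDomain C := inferInstance
  haveI hRC : Algebra.FiniteType R C :=
    (finiteType_blowupAlgebra (augIdeal ι) y (IsNoetherian.noetherian _)).equiv
      (Subalgebra.equivOfEq _ _ hC.symm)
  haveI : Algebra.FiniteType k C := Algebra.FiniteType.trans (S := R) inferInstance hRC
  -- `ιC` is a `k`-algebra involution `≠ 1`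
  have hιCk : ∀ a : k, ιC (algebraMap k C a) = algebraMap k C a := by
    intro a
    apply Subtype.ext
    rw [IsScalarTower.algebraMap_apply k R C a, hιC, hιk, Subalgebra.coe_algebraMap]
  let ιA : C ≃ₐ[k] C := AlgEquiv.ofRingEquiv (f := ιC) hιCk
  have hιA : ∀ c, ιA c = ιC c := fun _ => rfl
  have h1 : ιA ≠ 1 := by
    intro h
    have e0 := AlgEquiv.congr_fun h (algebraMap R C y)
    rw [AlgEquiv.one_apply, hιA] at e0
    have e1 := hιC y
    rw [e0, Subalgebra.coe_algebraMap, hy, map_neg] at e1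
    -- `e1 : algebraMap R L y = -algebraMap R L y`
    have e2 : algebraMap R (Localization.Away y) (2 * y) = 0 := by
      rw [map_mul, map_ofNat, two_mul]
      nth_rewrite 1 [e1]
      exact neg_add_cancel _
    have e3 : 2 * y = 0 := hinjL (by rw [e2, map_zero])
    obtain ⟨u, hu⟩ := h2.exists_left_inv
    apply hy0
    calc y = u * (2 * y) := by rw [← mul_assoc, hu, one_mul]
      _ = 0 := by rw [e3, mul_zero]
  have h2' : ιA ^ 2 = 1 := by
    ext c
    rw [pow_two, AlgEquiv.mul_apply, AlgEquiv.one_apply, hιA, hιA, hιCι]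
  have hprincA : (Ideal.span (Set.range fun u : C => ιA u - u)).IsPrincipal := by
    have e : Ideal.span (Set.range fun u : C => ιA u - u) = Ideal.span {algebraMap R C y} := hprinc
    rw [e]
    exact ⟨⟨algebraMap R C y, rfl⟩⟩
  -- K–L at `2` (H5): the invariants of `ιA` form a regular ring
  have hH5 : IsRegularRing (FixedPoints.subalgebra k C (Subgroup.zpowers ιA)) :=
    isRegularRing_fixedPoints_of_involution ιA h1 h2' hprincA
  -- the chart dictionary (o1): `S[K/t] ≅ C^{ιC}`
  obtain ⟨Φ, hinj, -, hrange⟩ := exists_chartRingHom ι hι j hj hfix h2 hy t ht C hC ιC hιC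
  have hmem : ∀ z, Φ z ∈ FixedPoints.subalgebra k C (Subgroup.zpowers ιA) := fun z =>
    (mem_fixedPoints_zpowers_iff_apply_eq ιA _).mpr ((hrange _).mp ⟨z, rfl⟩)
  have hg : Function.Bijective
      (Φ.codRestrict (FixedPoints.subalgebra k C (Subgroup.zpowers ιA)) hmem) := by
    refine ⟨fun a b hab => hinj (congrArg Subtype.val hab), fun f => ?_⟩
    obtain ⟨z, hz⟩ := (hrange f.1).mpr ((mem_fixedPoints_zpowers_iff_apply_eq ιA _).mp f.2)
    exact ⟨z, Subtype.ext hz⟩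
  haveI := hH5
  exact IsRegularRing.of_ringEquiv (RingEquiv.ofBijective _ hg).symm

include hιk hι h2 hj hfix in
/-- **One chart of `Bl_K(Spec R₊)` is regular**: for `y` anti-invariant and nonzero and `j t = y²`,
the affine blowup algebra `S[K/t]` (`K = I_ι.comap j`) is a regular ring — H4
(`involutionChartTerminal`: the lifted involution on `R[I_ι/y]` has augmentation ideal `(y)`),
`isRegularRing_involutionChart` (the chart ring is regular) and
`isRegularRing_blowupAlgebra_comap_of_chart`. [OURS · L1 W4.5c, card `mu2-strata-kl-twice` (ii)] -/
theorem isRegularRing_blowupAlgebra_comap_sq {y : R} (hy : ι y = -y) (hy0 : y ≠ 0) (t : S)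
    (ht : j t = y ^ 2) : IsRegularRing (blowupAlgebra ((augIdeal ι).comap j) t) := by
  obtain ⟨ιC, hιCι, hιC, hprinc⟩ := involutionChartTerminal ι hι h2 y hy
  haveI := isRegularRing_involutionChart ι hι h2 (mem_augIdeal_of_anti ι hι h2 hy)
  exact isRegularRing_blowupAlgebra_comap_of_chart ι hιk hι h2 j hj hfix hy hy0 t ht _
    (adjoin_ratio_eq_blowupAlgebra (augIdeal ι) y) ιC hιCι hιC hprinc

omit [IsDomain R] [IsRegularRing R] in
include hι h2 in
/-- The NONZERO anti-invariants still generate `I_ι` (H1 `augIdeal_eq_span_anti`). [folklore] -/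
theorem span_anti_ne_zero_eq_augIdeal :
    Ideal.span (Set.range (Subtype.val : {y : R // ι y = -y ∧ y ≠ 0} → R)) = augIdeal ι := by
  rw [augIdeal_eq_span_anti ι hι h2]
  apply le_antisymm
  · exact Ideal.span_mono (by rintro _ ⟨y, rfl⟩; exact y.2.1)
  · refine Ideal.span_le.mpr fun y hy => ?_
    by_cases hy0 : y = 0
    · rw [hy0]; exact zero_mem _
    · exact Ideal.subset_span ⟨⟨y, hy, hy0⟩, rfl⟩

include hιk hι h2 hj hfix in
/-- **(ii) `Bl_{I_ι ∩ R₊}(Spec R₊)` is a regular scheme** (K–L twice, second step; ring-involution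
form). For a regular domain `R` of finite type over a field `k`, a `k`-linear ring involution `ι`
with `2 ∈ Rˣ`, and `j : S ↪ R` the invariants, the blow-up of `Spec S` along `K = I_ι.comap j` is
regular: the `y²`-charts over the nonzero anti-invariants `y` cover it ((o1′)/(ε)
`affineBlowup_isRegular_of_sq_charts`, H1) and each chart ring `S[K/y²]` is regular
(`isRegularRing_blowupAlgebra_comap_sq`). [OURS · L1 W4.5c, card `mu2-strata-kl-twice` (ii)] -/
theorem isRegular_affineBlowup_comap_augIdeal_of_ringEquiv :
    Scheme.IsRegular (affineBlowup ((augIdeal ι).comap j)) := by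
  classical
  -- invariant square roots downstairs: `j (d y) = y²`
  have hex : ∀ y : {y : R // ι y = -y ∧ y ≠ 0}, ∃ s : S, j s = (y : R) ^ 2 := fun y =>
    exists_eq_of_invariant ι j hfix (by rw [map_pow, y.2.1, neg_sq])
  choose d hd using hex
  exact affineBlowup_isRegular_of_sq_charts ι hι j hj hfix h2 Subtype.val (fun y => y.2.1)
    (span_anti_ne_zero_eq_augIdeal ι hι h2) d hd
    fun y => isRegularRing_blowupAlgebra_comap_sq ι hιk hι h2 j hj hfix y.2.1 y.2.2 (d y) (hd y)

/-- **(ii) `Bl_{I_ι ∩ R₊}(Spec R₊)` is a regular scheme** — the form res-type-036's HP₂ ring side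
consumes (`ι : R ≃ₐ[k] R`; there `R := U₂^{σ_U}`, `ι := τ̄`, `j :=` the inclusion of
`R₀ := (U₂^{σ_U})^{τ̄}`). For a regular domain `R` of finite type over a field `k`, a `k`-algebra
involution `ι` with `2 ∈ Rˣ` and `j : S ↪ R` with range the `ι`-invariants,
`affineBlowup ((augIdeal ι).comap j)` is regular. [OURS · L1 W4.5c, card `mu2-strata-kl-twice` (ii);
res-L1-w45c-plan-1 ORDER 2026-08-27T14:00:34Z] -/
theorem isRegular_affineBlowup_comap_augIdeal {k R S : Type} [Field k] [CommRing R] [IsDomain R]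
    [IsRegularRing R] [Algebra k R] [Algebra.FiniteType k R] (ι : R ≃ₐ[k] R)
    (hι : ∀ x, ι (ι x) = x) (h2 : IsUnit (2 : R)) [CommRing S] (j : S →+* R)
    (hj : Function.Injective j) (hfix : ∀ x : R, x ∈ j.range ↔ ι x = x) :
    Scheme.IsRegular (affineBlowup ((augIdeal ι).comap j)) :=
  isRegular_affineBlowup_comap_augIdeal_of_ringEquiv (ι : R ≃+* R) ι.commutes hι h2 j hj hfix

/-- **(ii), inclusion-of-invariants form**: for a regular domain `R` of finite type over a field
`k` and a `k`-algebra involution `ι` with `2 ∈ Rˣ`, the blow-up of `Spec R^{⟨ι⟩}` along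
`I_ι ∩ R^{⟨ι⟩}` — `(augIdeal ι).comap (algebraMap R^{⟨ι⟩} R)`, `R^{⟨ι⟩} = FixedPoints.subalgebra k R ⟨ι⟩`
— is a regular scheme. [OURS · L1 W4.5c, card `mu2-strata-kl-twice` (ii)] -/
theorem isRegular_affineBlowup_comap_augIdeal_fixedPoints {k R : Type} [Field k] [CommRing R]
    [IsDomain R] [IsRegularRing R] [Algebra k R] [Algebra.FiniteType k R] (ι : R ≃ₐ[k] R)
    (hι : ∀ x, ι (ι x) = x) (h2 : IsUnit (2 : R)) :
    Scheme.IsRegular (affineBlowup ((augIdeal ι).comap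
      (algebraMap (FixedPoints.subalgebra k R (Subgroup.zpowers ι)) R))) := by
  refine isRegular_affineBlowup_comap_augIdeal ι hι h2 _ Subtype.val_injective fun x => ?_
  rw [RingHom.mem_range]
  constructor
  · rintro ⟨v, rfl⟩
    exact (mem_fixedPoints_zpowers_iff_apply_eq ι _).mp v.2
  · intro hx
    exact ⟨⟨x, (mem_fixedPoints_zpowers_iff_apply_eq ι _).mpr hx⟩, rfl⟩

end Summit.ResolutionOfSingularities.ResolutionOfSingularities.Theorems.WildQuotientResolution.InvolutionExit

end
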